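import Summits.QuantumFields.YangMills.Theorems.F4SubCurvatureDoorSubCurvatureClauseMoebiusRowOfDebts
import Summits.QuantumFields.YangMills.Theorems.F4SubCurvatureDoorSubCurvatureClauseUniformPlaquetteFreezing
import Literature.MathematicalPhysics.QuantumFieldTheory.SpeciesTimeReflection
import HarnessLib

/-!
# `MoebiusRow` debt certificate — the lattice-artefact floor U0 `LatticeUVFloor` DISCHARGED (volume-uniform freezing)

Helper file (`--supports stmt-QuantumFields-23763 --as helper`; free-hands seat `ym-line-frs-p2` g20).  Definition-free, 0 sorry, standard
axioms.  No item is closed; no summit, no crux and no mass gap is proved by this file.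

Of the three debts of ✓`…MoebiusRowDebts.moebiusRow_of_debts : CompositeAFDebts → MoebiusRow` (typing ym-idea-3 g26), the S–M one is
U0 = `LatticeUVFloor r`: at FIXED lattice heights `t ≤ T` the symmetrised on-axis coupling `Gs(β,L,t) = max((2t)⁸ lCC(Q^θ,Q,2t), (2t)⁸ lCC(Q,Q^θ,2t))`
tends to `0` as `β → ∞`, UNIFORMLY in the torus.  This file proves it for every compact `G` and every lattice representation `r`:

* `abs_cov_le_of_range`, `cov_const_sub` (§1): on a probability space, two `[0, 2c]`-valued observables with equal means `m` have `|Cov| ≤ 2c·m`;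
* `abs_corr_le_deficit_of_means`, ★ `abs_lcc_mixed_le_deficit`, ★ `abs_lcc_mixed'_le_deficit` (§2): BOTH mirror orders of the reflected
  curvature pair obey `|lCC(·,·,n)| ≤ 2 c_N ∫ (c_N − P(Ũ)) dμ_{β,S}` for every `β`, side `S`, lag `n` (`c_N = Σ_{i<j} N`, `P` the corner action
  density; the `(Q,Q)` order is seat c4's `abs_latticeConnectedCorr_le_deficit`) — reflection invariance of Wilson's torus
  measure (✓`integral_comp_negReflect_eq`, ✓`torusLift_negReflect`) supplies the equal means;
* ★ `latticeUVFloor_holds` (§3): `LatticeUVFloor r`, from volume-uniform one-point freezing ✓`…UniformPlaquetteFreezing.uniform_plaquette_freezing_rep`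
  (Jensen/small-ball bound on the mean action; LatticeRep-specialised re-derivation of seat c4's ⟨stmt-QuantumFields-10524⟩ files, whose modules the farm does not serve).

So `CompositeAFDebts` now reads: U0 ✓ ∧ ∃(u → 0⁺) 𝒢 η₁, U1 ∧ U2 — the two XL letters (lattice → continuum dictionary; composite asymptotic freedom
of the profile) are ALL that is open on the UV wall of ⟨23763⟩'s line.  [cite: OsterwalderSeiler1978, §2].

HONEST LABEL: lattice bookkeeping; U1, U2, `MoebiusRow`, `CrossoverDecay`, ⟨23763⟩, ⟨24275⟩ OPEN; the Yang–Mills mass gap is NOT proved; no summit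
is proved by a line.
-/

set_option autoImplicit false

noncomputable section

open MeasureTheory Filter Topology
open Literature.MathematicalPhysics.QuantumFieldTheory Literature.MathematicalPhysics.QuantumLattice
open Summit.QuantumFields.YangMills.Theorems.TunedSequenceExists.Negative.Freezing (secondCountable_of_latticeRep)
open Summit.QuantumFields.YangMills.Theorems.F4SubCurvatureDoorSubCurvatureClauseUniformPlaquetteFreezing
  (uniform_plaquette_freezing_rep deficit_range_rep)
open Summit.QuantumFields.YangMills.Cruxes.SubCurvatureClause.MoebiusRowDebts (axisG axisG' axisGs LatticeUVFloor)

namespace Summit.QuantumFields.YangMills.Theorems.F4SubCurvatureDoorSubCurvatureClauseLatticeUVFloor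

/-! ## §1 A covariance bound for bounded non-negative observables with equal means -/

/-- **Covariance of two `[0, 2c]`-valued observables with equal means** on a probability space: `|E[fg] − E[f]E[g]| ≤ 2c·E[f]`. [folklore] -/
theorem abs_cov_le_of_range {X : Type*} [MeasurableSpace X] (μ : Measure X) [IsProbabilityMeasure μ] {f g : X → ℝ} {c : ℝ}
    (hf : Measurable f) (hg : Measurable g) (hf0 : ∀ x, 0 ≤ f x) (hg0 : ∀ x, 0 ≤ g x) (hf2 : ∀ x, f x ≤ 2 * c) (hg2 : ∀ x, g x ≤ 2 * c)
    (hmean : ∫ x, g x ∂μ = ∫ x, f x ∂μ) :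
    |(∫ x, f x * g x ∂μ) - (∫ x, f x ∂μ) * ∫ x, g x ∂μ| ≤ 2 * c * ∫ x, f x ∂μ := by
  have hbd : ∀ {h : X → ℝ}, Measurable h → (∀ x, 0 ≤ h x) → (∀ x, h x ≤ 2 * c) → Integrable h μ := fun hh h0 h2 =>
    Integrable.of_bound hh.aestronglyMeasurable (2 * c) (ae_of_all _ fun x => by
      rw [Real.norm_eq_abs, abs_of_nonneg (h0 x)]; exact h2 x)
  have iF : Integrable f μ := hbd hf hf0 hf2
  have iG : Integrable g μ := hbd hg hg0 hg2
  have iFG : Integrable (fun x => f x * g x) μ := by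
    refine Integrable.of_bound (hf.mul hg).aestronglyMeasurable (2 * c * (2 * c)) (ae_of_all _ fun x => ?_)
    rw [Real.norm_eq_abs, abs_of_nonneg (mul_nonneg (hf0 x) (hg0 x))]
    exact mul_le_mul (hf2 x) (hg2 x) (hg0 x) (by linarith [hf0 x, hf2 x])
  rw [hmean]
  have hI0 : 0 ≤ ∫ x, f x ∂μ := integral_nonneg hf0
  have hI2 : ∫ x, f x ∂μ ≤ 2 * c := by
    calc ∫ x, f x ∂μ ≤ ∫ _x, 2 * c ∂μ := integral_mono iF (integrable_const _) hf2
      _ = 2 * c := by simp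
  have hup : ∫ x, f x * g x ∂μ ≤ 2 * c * ∫ x, f x ∂μ := by
    calc ∫ x, f x * g x ∂μ ≤ ∫ x, 2 * c * g x ∂μ :=
          integral_mono iFG (iG.const_mul _) fun x => mul_le_mul_of_nonneg_right (hf2 x) (hg0 x)
      _ = 2 * c * ∫ x, f x ∂μ := by rw [integral_const_mul, hmean]
  have hlow : 0 ≤ ∫ x, f x * g x ∂μ := integral_nonneg fun x => mul_nonneg (hf0 x) (hg0 x)
  have hsq : (∫ x, f x ∂μ) * ∫ x, f x ∂μ ≤ 2 * c * ∫ x, f x ∂μ := mul_le_mul_of_nonneg_right hI2 hI0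
  rw [abs_le]
  constructor <;> nlinarith

/-- **Centring algebra**: the connected correlation of `c − f` and `c − g` is that of `f` and `g`. [folklore] -/
theorem cov_const_sub {X : Type*} [MeasurableSpace X] (μ : Measure X) [IsProbabilityMeasure μ] {f g : X → ℝ} (c : ℝ)
    (iF : Integrable f μ) (iG : Integrable g μ) (iFG : Integrable (fun x => f x * g x) μ) :
    (∫ x, (c - f x) * (c - g x) ∂μ) - (∫ x, (c - f x) ∂μ) * ∫ x, (c - g x) ∂μ =
      (∫ x, f x * g x ∂μ) - (∫ x, f x ∂μ) * ∫ x, g x ∂μ := by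
  have e1 : ∫ x, (c - f x) * (c - g x) ∂μ = c * c - c * ∫ x, g x ∂μ - c * ∫ x, f x ∂μ + ∫ x, f x * g x ∂μ := by
    have hexp : (fun x => (c - f x) * (c - g x)) = fun x => c * c - c * g x - c * f x + f x * g x := by funext x; ring
    rw [hexp, integral_add, integral_sub, integral_sub, integral_const, integral_const_mul, integral_const_mul]
    · simp
    · exact integrable_const _
    · exact iG.const_mul _
    · exact (integrable_const _).sub (iG.const_mul _)
    · exact iF.const_mul _
    · exact ((integrable_const _).sub (iG.const_mul _)).sub (iF.const_mul _)
    · exact iFG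
  have e2 : ∫ x, (c - f x) ∂μ = c - ∫ x, f x ∂μ := by
    rw [integral_sub (integrable_const _) iF, integral_const]; simp
  have e3 : ∫ x, (c - g x) ∂μ = c - ∫ x, g x ∂μ := by
    rw [integral_sub (integrable_const _) iG, integral_const]; simp
  rw [e1, e2, e3]
  ring

/-! ## §2 Both mirror orders are controlled by the mean corner deficit -/

section Torus

variable {G : Type} [Group G] [TopologicalSpace G] [IsTopologicalGroup G] [CompactSpace G]
  [MeasurableSpace G] [BorelSpace G]

/-- **Two corner-density insertions against the mean corner deficit.**  For measurable maps `Φ, Ψ` of the torus configuration space into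
`ℤ⁴`-configurations that preserve the mean of the corner density `P` (`∫ P(ΦU) = ∫ P(ΨU) = ∫ P(Ũ)` under Wilson's measure), the connected correlation
obeys `|∫ P(ΦU) P(ΨU) − ∫ P(ΦU) ∫ P(ΨU)| ≤ 2 c_N ∫ (c_N − P(Ũ))` (`c_N = Σ_{i<j} N`). [folklore] -/
theorem abs_corr_le_deficit_of_means {S : ℕ} [NeZero S] (r : LatticeRep G) (β : ℝ)
    (Φ Ψ : GaugeConfig 4 S G → LGConfig 4 G) (hΦ : Measurable Φ) (hΨ : Measurable Ψ)
    (hΦm : ∫ U, actionDensity r.ρ (Φ U) ∂(wilsonMeasure (d := 4) (L := S) r.ρ β) =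
      ∫ U, actionDensity r.ρ (torusLift S U) ∂(wilsonMeasure (d := 4) (L := S) r.ρ β))
    (hΨm : ∫ U, actionDensity r.ρ (Ψ U) ∂(wilsonMeasure (d := 4) (L := S) r.ρ β) =
      ∫ U, actionDensity r.ρ (torusLift S U) ∂(wilsonMeasure (d := 4) (L := S) r.ρ β)) :
    |(∫ U, actionDensity r.ρ (Φ U) * actionDensity r.ρ (Ψ U) ∂(wilsonMeasure (d := 4) (L := S) r.ρ β)) -
        (∫ U, actionDensity r.ρ (Φ U) ∂(wilsonMeasure (d := 4) (L := S) r.ρ β)) *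
          ∫ U, actionDensity r.ρ (Ψ U) ∂(wilsonMeasure (d := 4) (L := S) r.ρ β)| ≤
      2 * (∑ i : Fin 4, ∑ j : Fin 4, if i < j then (r.N : ℝ) else 0) *
        ∫ U, ((∑ i : Fin 4, ∑ j : Fin 4, if i < j then (r.N : ℝ) else 0) - actionDensity r.ρ (torusLift S U))
          ∂(wilsonMeasure (d := 4) (L := S) r.ρ β) := by
  haveI : SecondCountableTopology G := secondCountable_of_latticeRep r
  set μ := wilsonMeasure (d := 4) (L := S) r.ρ β with hμ
  haveI := isProbabilityMeasure_wilsonMeasure (d := 4) (L := S) r.ρ r.continuous β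
  set c : ℝ := (∑ i : Fin 4, ∑ j : Fin 4, if i < j then (r.N : ℝ) else 0) with hc
  -- integrability of corner densities read through any measurable map
  have iP : ∀ {Θ : GaugeConfig 4 S G → LGConfig 4 G}, Measurable Θ → Integrable (fun U => actionDensity r.ρ (Θ U)) μ := by
    intro Θ hΘ
    refine Integrable.of_bound (((continuous_actionDensity r.continuous).measurable.comp hΘ).aestronglyMeasurable) c
      (ae_of_all _ fun U => ?_)
    have h1 := (deficit_range_rep r (Θ U)).1
    have h2 := (deficit_range_rep r (Θ U)).2
    rw [Real.norm_eq_abs, abs_le]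
    constructor <;> linarith
  -- the two deficits
  set dX : GaugeConfig 4 S G → ℝ := fun U => c - actionDensity r.ρ (Φ U) with hdX
  set dY : GaugeConfig 4 S G → ℝ := fun U => c - actionDensity r.ρ (Ψ U) with hdY
  have hX0 : ∀ U, 0 ≤ dX U := fun U => (deficit_range_rep r _).1
  have hY0 : ∀ U, 0 ≤ dY U := fun U => (deficit_range_rep r _).1
  have hX2 : ∀ U, dX U ≤ 2 * c := fun U => (deficit_range_rep r _).2
  have hY2 : ∀ U, dY U ≤ 2 * c := fun U => (deficit_range_rep r _).2
  have hmA : Measurable fun U : GaugeConfig 4 S G => actionDensity r.ρ (Φ U) :=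
    (continuous_actionDensity r.continuous).measurable.comp hΦ
  have hmB : Measurable fun U : GaugeConfig 4 S G => actionDensity r.ρ (Ψ U) :=
    (continuous_actionDensity r.continuous).measurable.comp hΨ
  have hmX : Measurable dX := measurable_const.sub hmA
  have hmY : Measurable dY := measurable_const.sub hmB
  have iX : Integrable dX μ := (integrable_const c).sub (iP hΦ)
  have iY : Integrable dY μ := (integrable_const c).sub (iP hΨ)
  have iXY : Integrable (fun U => dX U * dY U) μ := by
    refine Integrable.of_bound (hmX.mul hmY).aestronglyMeasurable (2 * c * (2 * c)) (ae_of_all _ fun U => ?_)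
    rw [Real.norm_eq_abs, abs_of_nonneg (mul_nonneg (hX0 U) (hY0 U))]
    exact mul_le_mul (hX2 U) (hY2 U) (hY0 U) (by linarith [hX0 U, hX2 U])
  -- equal means
  have eX : ∫ U, dX U ∂μ = c - ∫ U, actionDensity r.ρ (torusLift S U) ∂μ := by
    simp only [hdX]
    rw [integral_sub (integrable_const _) (iP hΦ), integral_const, hΦm]; simp
  have eY : ∫ U, dY U ∂μ = c - ∫ U, actionDensity r.ρ (torusLift S U) ∂μ := by
    simp only [hdY]
    rw [integral_sub (integrable_const _) (iP hΨ), integral_const, hΨm]; simp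
  have hmean : ∫ U, dY U ∂μ = ∫ U, dX U ∂μ := by rw [eX, eY]
  have eD : ∫ U, (c - actionDensity r.ρ (torusLift S U)) ∂μ = ∫ U, dX U ∂μ := by
    rw [eX, integral_sub (integrable_const _) (iP (measurable_torusLift S)), integral_const]; simp
  -- the correlator in terms of the deficits
  have hA : ∀ U, actionDensity r.ρ (Φ U) = c - dX U := fun U => by simp [hdX]
  have hB : ∀ U, actionDensity r.ρ (Ψ U) = c - dY U := fun U => by simp [hdY]
  simp only [hA, hB]
  rw [cov_const_sub μ c iX iY iXY, eD]
  exact abs_cov_le_of_range μ hmX hmY hX0 hY0 hX2 hY2 hmean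

/-- ★ **Order `(Q^θ, Q)`**: `|lCC_{β,S}(Q^θ, Q, n)| ≤ 2 c_N ∫ (c_N − P(Ũ)) dμ_{β,S}` for every `β`, side `S`, lag `n`. [cite: OsterwalderSeiler1978, §2] -/
theorem abs_lcc_mixed_le_deficit {S : ℕ} [NeZero S] (r : LatticeRep G) (β : ℝ) (n : ℕ) :
    |latticeConnectedCorr r.ρ β S r.curvature.timeReflect.F r.curvature.F n| ≤
      2 * (∑ i : Fin 4, ∑ j : Fin 4, if i < j then (r.N : ℝ) else 0) *
        ∫ U, ((∑ i : Fin 4, ∑ j : Fin 4, if i < j then (r.N : ℝ) else 0) - actionDensity r.ρ (torusLift S U))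
          ∂(wilsonMeasure (d := 4) (L := S) r.ρ β) := by
  haveI : SecondCountableTopology G := secondCountable_of_latticeRep r
  have hF : ∀ W, r.curvature.F W = actionDensity r.ρ W := fun W => rfl
  have hlift := measurable_torusLift (d := 4) (G := G) S
  have hΦ : Measurable fun U : GaugeConfig 4 S G => cfgReflect (torusLift S U) := measurable_cfgReflect.comp hlift
  have hΨ : Measurable fun U : GaugeConfig 4 S G => configShift (-Pi.single 0 (n : ℤ)) (torusLift S U) :=
    (configShift _).measurable.comp hlift
  have hΦm : ∫ U, actionDensity r.ρ (cfgReflect (torusLift S U)) ∂(wilsonMeasure (d := 4) (L := S) r.ρ β) =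
      ∫ U, actionDensity r.ρ (torusLift S U) ∂(wilsonMeasure (d := 4) (L := S) r.ρ β) := by
    have h := integral_comp_negReflect_eq (d := 4) (L := S) r.ρ r.continuous β
      (fun U : GaugeConfig 4 S G => actionDensity r.ρ (torusLift S U))
    simp only [torusLift_negReflect] at h
    exact h
  have hΨm : ∫ U, actionDensity r.ρ (configShift (-Pi.single 0 (n : ℤ)) (torusLift S U)) ∂(wilsonMeasure (d := 4) (L := S) r.ρ β) =
      ∫ U, actionDensity r.ρ (torusLift S U) ∂(wilsonMeasure (d := 4) (L := S) r.ρ β) :=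
    integral_comp_configShift_torusLift (d := 4) (S := S) r.ρ β (actionDensity r.ρ) _
  have key := abs_corr_le_deficit_of_means r β _ _ hΦ hΨ hΦm hΨm
  rw [hΨm] at key
  unfold latticeConnectedCorr
  simp only [LocalGaugeObservable.timeReflect_F, hF]
  exact key

/-- ★ **Order `(Q, Q^θ)`**: `|lCC_{β,S}(Q, Q^θ, n)| ≤ 2 c_N ∫ (c_N − P(Ũ)) dμ_{β,S}` for every `β`, side `S`, lag `n`. [cite: OsterwalderSeiler1978, §2] -/
theorem abs_lcc_mixed'_le_deficit {S : ℕ} [NeZero S] (r : LatticeRep G) (β : ℝ) (n : ℕ) :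
    |latticeConnectedCorr r.ρ β S r.curvature.F r.curvature.timeReflect.F n| ≤
      2 * (∑ i : Fin 4, ∑ j : Fin 4, if i < j then (r.N : ℝ) else 0) *
        ∫ U, ((∑ i : Fin 4, ∑ j : Fin 4, if i < j then (r.N : ℝ) else 0) - actionDensity r.ρ (torusLift S U))
          ∂(wilsonMeasure (d := 4) (L := S) r.ρ β) := by
  haveI : SecondCountableTopology G := secondCountable_of_latticeRep r
  have hF : ∀ W, r.curvature.F W = actionDensity r.ρ W := fun W => rfl
  have hlift := measurable_torusLift (d := 4) (G := G) S
  have hΦ : Measurable fun U : GaugeConfig 4 S G => torusLift S U := hlift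
  have hΨ : Measurable fun U : GaugeConfig 4 S G => cfgReflect (configShift (-Pi.single 0 (n : ℤ)) (torusLift S U)) :=
    measurable_cfgReflect.comp ((configShift _).measurable.comp hlift)
  have hΨm : ∫ U, actionDensity r.ρ (cfgReflect (configShift (-Pi.single 0 (n : ℤ)) (torusLift S U)))
        ∂(wilsonMeasure (d := 4) (L := S) r.ρ β) =
      ∫ U, actionDensity r.ρ (torusLift S U) ∂(wilsonMeasure (d := 4) (L := S) r.ρ β) := by
    have e : ∀ U : GaugeConfig 4 S G, cfgReflect (configShift (-Pi.single 0 (n : ℤ)) (torusLift S U)) =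
        configShift (siteReflect (-Pi.single 0 (n : ℤ))) (torusLift S U.negReflect) := by
      intro U; rw [cfgReflect_configShift, torusLift_negReflect]
    simp_rw [e]
    rw [integral_comp_negReflect_eq (d := 4) (L := S) r.ρ r.continuous β
      (fun U : GaugeConfig 4 S G => actionDensity r.ρ (configShift (siteReflect (-Pi.single 0 (n : ℤ))) (torusLift S U)))]
    exact integral_comp_configShift_torusLift (d := 4) (S := S) r.ρ β (actionDensity r.ρ) _
  have hR : ∫ U, actionDensity r.ρ (cfgReflect (torusLift S U)) ∂(wilsonMeasure (d := 4) (L := S) r.ρ β) =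
      ∫ U, actionDensity r.ρ (torusLift S U) ∂(wilsonMeasure (d := 4) (L := S) r.ρ β) := by
    have h := integral_comp_negReflect_eq (d := 4) (L := S) r.ρ r.continuous β
      (fun U : GaugeConfig 4 S G => actionDensity r.ρ (torusLift S U))
    simp only [torusLift_negReflect] at h
    exact h
  have key := abs_corr_le_deficit_of_means r β _ _ hΦ hΨ rfl hΨm
  rw [hΨm] at key
  unfold latticeConnectedCorr
  simp only [LocalGaugeObservable.timeReflect_F, hF]
  rw [hR]
  exact key

/-! ## §3 ★ U0 discharged -/

/-- ★ **`LatticeUVFloor r` holds** for every compact `G` and every lattice representation `r`: at fixed lattice heights `t ≤ T` the symmetrised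
on-axis coupling is `≤ δ` for all `β ≥ β₁(δ, T)` and ALL tori `2L+1` with `4t+8 ≤ L` (volume-uniform freezing of Wilson's measure).
[cite: OsterwalderSeiler1978, §2] -/
theorem latticeUVFloor_holds (r : LatticeRep G) : LatticeUVFloor r := by
  intro δ hδ T
  haveI : SecondCountableTopology G := secondCountable_of_latticeRep r
  set c : ℝ := (∑ i : Fin 4, ∑ j : Fin 4, if i < j then (r.N : ℝ) else 0) with hc
  have hc0 : 0 ≤ c := Finset.sum_nonneg fun _ _ => Finset.sum_nonneg fun _ _ => by split_ifs <;> positivity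
  set K : ℝ := ((2 * T : ℕ) : ℝ) ^ 8 * (2 * c) with hK
  have hK0 : 0 ≤ K := by positivity
  obtain ⟨β₀, -, hfr⟩ := uniform_plaquette_freezing_rep r (show 0 < δ / (K + 1) by positivity)
  refine ⟨β₀, fun β hβ L t _ht htT _hL => ?_⟩
  haveI : NeZero (2 * L + 1) := ⟨by omega⟩
  have hdef : ∫ U, (c - actionDensity r.ρ (torusLift (2 * L + 1) U)) ∂(wilsonMeasure (d := 4) (L := 2 * L + 1) r.ρ β) ≤ δ / (K + 1) :=
    hfr β hβ (2 * L + 1)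
  have hdef0 : 0 ≤ ∫ U, (c - actionDensity r.ρ (torusLift (2 * L + 1) U)) ∂(wilsonMeasure (d := 4) (L := 2 * L + 1) r.ρ β) :=
    integral_nonneg fun U => (deficit_range_rep r _).1
  have hpow : ((2 * t : ℕ) : ℝ) ^ 8 ≤ ((2 * T : ℕ) : ℝ) ^ 8 :=
    pow_le_pow_left₀ (by positivity) (by exact_mod_cast (show 2 * t ≤ 2 * T by omega)) 8
  have hfin : K * (δ / (K + 1)) ≤ δ := by
    rw [mul_div_assoc', div_le_iff₀ (by positivity)]; nlinarith
  have bound : ∀ x : ℝ, |x| ≤ 2 * c * ∫ U, (c - actionDensity r.ρ (torusLift (2 * L + 1) U)) ∂(wilsonMeasure (d := 4) (L := 2 * L + 1) r.ρ β) →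
      ((2 * t : ℕ) : ℝ) ^ 8 * x ≤ δ := by
    intro x hx
    calc ((2 * t : ℕ) : ℝ) ^ 8 * x ≤ ((2 * t : ℕ) : ℝ) ^ 8 * |x| := mul_le_mul_of_nonneg_left (le_abs_self x) (by positivity)
      _ ≤ ((2 * T : ℕ) : ℝ) ^ 8 * (2 * c * ∫ U, (c - actionDensity r.ρ (torusLift (2 * L + 1) U))
            ∂(wilsonMeasure (d := 4) (L := 2 * L + 1) r.ρ β)) := mul_le_mul hpow hx (abs_nonneg _) (by positivity)
      _ = K * ∫ U, (c - actionDensity r.ρ (torusLift (2 * L + 1) U)) ∂(wilsonMeasure (d := 4) (L := 2 * L + 1) r.ρ β) := by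
            rw [hK]; ring
      _ ≤ K * (δ / (K + 1)) := mul_le_mul_of_nonneg_left hdef hK0
      _ ≤ δ := hfin
  unfold axisGs axisG axisG'
  exact max_le (bound _ (abs_lcc_mixed_le_deficit r β (2 * t))) (bound _ (abs_lcc_mixed'_le_deficit r β (2 * t)))

end Torus

end Summit.QuantumFields.YangMills.Theorems.F4SubCurvatureDoorSubCurvatureClauseLatticeUVFloor

end
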